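import Summits.AtomisticToContinuum.HydrodynamicLimit.Theorems.JParityClosureLocalSecondLawContactCondLaw
import Summits.AtomisticToContinuum.HydrodynamicLimit.Theorems.BoxDissipativeWeakStrongLocalGibbsFineScaleStaticsPrelim
import Mathlib.MeasureTheory.Function.AEEqOfIntegral

/-!
# Stub B′|ML (`stub_initialMatchingOfStatics`) of the line `contact-asymmetry-information` for the crux `LocalSecondLaw`
(stmt-AtomisticToContinuum-13081) — part 1: the one-body POSITION density of a bounded tilt at `s = 0`

For the local Gibbs law `P_N = localGibbsLaw σ a₀ u₀ θ₀ N Φ`, a cell `S` with `P_N(S) ≥ δ″`, the bounded tilt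
`ν = P_N(· | S)` (`condLaw`) and a one-particle density `f` of `ν` on `[0, τ]` (`IsOneParticleDensity`), write
`n_S(y) = ∫ f(0, y, v) dv` for the time-zero position density.  This file proves:

* bookkeeping at `s = 0` (`tv_integrable_slice_zero`, `tv_integral_fst_mul_eq`, `tv_onePt_pos`): `f(0,·)` is integrable,
  Fubini, and `E_ν[(N+1)⁻¹ Σᵢ g(xᵢ)] = ∫ g n_S` for bounded measurable `g : 𝕋³ → ℝ`;
* the bridge from phase space to the statics (`tv_integral_pos_localGibbsLaw`, `tv_meanSquare_le_of_statics`): a position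
  statistic of `P_N` is a `posGibbsMeasure` statistic, so the UNIFORM-in-`g` mean-square law of large numbers of the
  canonical hard-sphere gas (the registered stub `stub_oneBodyStatics`, taken here as the hypothesis `hML` verbatim) bounds
  `E_{P_N}((N+1)⁻¹ Σ g(xᵢ) − ∫ g ρ₀)² ≤ ε₁` for every measurable `|g| ≤ 1`, `ρ₀ = rhoLim (profileOf a₀) σ`;
* **`tv_posDensity_L1_le`** — conditioning cannot move the one-body position law: for every `κ > 0` and mass floor
  `δ″ > 0`, eventually in `N`, for EVERY cell `S` with `P_N(S) ≥ δ″`, every flow and every one-particle density `f` of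
  `P_N(·|S)`: `∫ |n_S − ρ₀| dy ≤ κ` (domination `ν ≤ δ″⁻¹ P_N`, Cauchy–Schwarz `E|X| ≤ √(E X²)` under `P_N`, the uniform
  mean-square bound with the sign test function `g = sgn(n_S − ρ₀)`);
* **`tv_posDensity_le_ae`** — and cannot concentrate it: `n_S ≤ 2M/δ″` a.e. (`M = sup β`), from the one-point insertion
  bound `E_{N+1}[g(q₀)] ≤ 2 ∫ g dμ` of the cluster files (`LGFS.onePt_le_two_mul`).

These are the two inputs of the position-entropy half of B′ (upper semicontinuity of `∫ b_r n_S log n_S`).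

References: H. Spohn, *Large Scale Dynamics of Interacting Particles* (1991), Part I §2.3 (local equilibrium states and
their law of large numbers); I. Csiszár, Ann. Probab. 3 (1975) 146–158 (conditioning).  Lead c16
(prover-line-stmt-AtomisticToContinuum-13081-c16-0).
-/

noncomputable section

open scoped BigOperators Topology Classical MeasureTheory ENNReal InnerProductSpace
open Filter Set MeasureTheory Function
open Literature.MathematicalPhysics.KineticTheory
open Literature.MathematicalPhysics.StatisticalMechanics (efR)
open Literature.Analysis.FluidPDE
open Summit.AtomisticToContinuum.HydrodynamicLimit.Theorems.LocalSecondLawNegative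
open Summit.AtomisticToContinuum.HydrodynamicLimit.Theorems.LocalSecondLawLedger
open Summit.AtomisticToContinuum.HydrodynamicLimit.Theorems.LocalSecondLawContact

namespace Summit.AtomisticToContinuum.HydrodynamicLimit.Theorems.LocalSecondLawInitialMatching

variable {N : ℕ}

/-! ### The time-zero slice of a one-particle density -/

/-- The time-zero slice `f(0, ·)` of a one-particle density of a probability law is integrable (its integral is `1`). -/
theorem tv_integrable_slice_zero {σ τ : ℝ} (ν : Measure (Phase N)) [IsProbabilityMeasure ν] (Φ : Flow σ N)
    (f : Pt1 → ℝ) (hτ : 0 ≤ τ) (hf : IsOneParticleDensity τ ν Φ f) :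
    Integrable (fun p : T3 × V3 => f (0, p)) :=
  integrable_of_integral_eq_one (contactB_onePt_zero_mass ν Φ f hτ hf)

/-- The time-zero slice is jointly measurable on `𝕋³ × ℝ³`. -/
theorem tv_measurable_slice_zero {σ τ : ℝ} {ν : Measure (Phase N)} {Φ : Flow σ N} {f : Pt1 → ℝ}
    (hf : IsOneParticleDensity τ ν Φ f) : Measurable fun p : T3 × V3 => f (0, p) :=
  hf.2.1.comp (measurable_const.prodMk measurable_id)

/-- The position density `n(y) = ∫ f(0, y, v) dv` is measurable. -/
theorem tv_measurable_posDensity {σ τ : ℝ} {ν : Measure (Phase N)} {Φ : Flow σ N} {f : Pt1 → ℝ}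
    (hf : IsOneParticleDensity τ ν Φ f) : Measurable fun y : T3 => ∫ v : V3, f (0, y, v) :=
  ((tv_measurable_slice_zero hf).stronglyMeasurable.integral_prod_right').measurable

/-- The position density is non-negative. -/
theorem tv_posDensity_nonneg {σ τ : ℝ} {ν : Measure (Phase N)} {Φ : Flow σ N} {f : Pt1 → ℝ}
    (hf : IsOneParticleDensity τ ν Φ f) (y : T3) : 0 ≤ ∫ v : V3, f (0, y, v) :=
  integral_nonneg fun _ => hf.1 _

/-- **Fubini at `s = 0`**: `∫ g(y) f(0, y, v) d(y, v) = ∫ g(y) n(y) dy` for bounded measurable `g`. -/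
theorem tv_integral_fst_mul_eq {σ τ : ℝ} (ν : Measure (Phase N)) [IsProbabilityMeasure ν] (Φ : Flow σ N)
    (f : Pt1 → ℝ) (hτ : 0 ≤ τ) (hf : IsOneParticleDensity τ ν Φ f) {g : T3 → ℝ} (hg : Measurable g) {C : ℝ}
    (hgC : ∀ y, |g y| ≤ C) :
    ∫ p : T3 × V3, g p.1 * f (0, p) = ∫ y : T3, g y * ∫ v : V3, f (0, y, v) := by
  have hint : Integrable (fun p : T3 × V3 => g p.1 * f (0, p))
      ((volume : Measure T3).prod (volume : Measure V3)) := by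
    rw [← Measure.volume_eq_prod]
    exact (tv_integrable_slice_zero ν Φ f hτ hf).bdd_mul (hg.comp measurable_fst).aestronglyMeasurable
      (ae_of_all _ fun p => by rw [Real.norm_eq_abs]; exact hgC p.1)
  calc ∫ p : T3 × V3, g p.1 * f (0, p)
      = ∫ p : T3 × V3, g p.1 * f (0, p) ∂((volume : Measure T3).prod (volume : Measure V3)) := by
        rw [← Measure.volume_eq_prod]
    _ = ∫ y : T3, ∫ v : V3, g (y, v).1 * f (0, (y, v)) := integral_prod _ hint
    _ = ∫ y : T3, g y * ∫ v : V3, f (0, y, v) := by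
        refine integral_congr_ae (ae_of_all _ fun y => ?_)
        exact integral_const_mul (g y) _

/-- The position density integrates to `1`. -/
theorem tv_integral_posDensity {σ τ : ℝ} (ν : Measure (Phase N)) [IsProbabilityMeasure ν] (Φ : Flow σ N)
    (f : Pt1 → ℝ) (hτ : 0 ≤ τ) (hf : IsOneParticleDensity τ ν Φ f) :
    ∫ y : T3, ∫ v : V3, f (0, y, v) = 1 := by
  have h := tv_integral_fst_mul_eq ν Φ f hτ hf (g := fun _ => (1 : ℝ)) measurable_const (C := 1)
    (fun _ => by simp)
  simp only [one_mul] at h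
  rw [← h]
  exact contactB_onePt_zero_mass ν Φ f hτ hf

/-- The position density is integrable. -/
theorem tv_integrable_posDensity {σ τ : ℝ} (ν : Measure (Phase N)) [IsProbabilityMeasure ν] (Φ : Flow σ N)
    (f : Pt1 → ℝ) (hτ : 0 ≤ τ) (hf : IsOneParticleDensity τ ν Φ f) :
    Integrable fun y : T3 => ∫ v : V3, f (0, y, v) :=
  integrable_of_integral_eq_one (tv_integral_posDensity ν Φ f hτ hf)

/-- **Duality for position test functions at `s = 0`**: `E_ν[(N+1)⁻¹ Σᵢ g(xᵢ)] = ∫ g n` for bounded measurable `g`,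
whenever `Φ₀ = id` `ν`-a.s. (with integrability of the statistic). -/
theorem tv_onePt_pos {σ τ : ℝ} (ν : Measure (Phase N)) [IsProbabilityMeasure ν] (Φ : Flow σ N) (f : Pt1 → ℝ)
    (hτ : 0 ≤ τ) (hf : IsOneParticleDensity τ ν Φ f) (h0 : ∀ᵐ z ∂ν, Φ.flow 0 z = z) {g : T3 → ℝ}
    (hg : Measurable g) {C : ℝ} (hgC : ∀ y, |g y| ≤ C) :
    Integrable (fun z : Phase N => (N + 1 : ℝ)⁻¹ * ∑ i : Fin (N + 1), g (z i).1) ν ∧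
      ∫ z, ((N + 1 : ℝ)⁻¹ * ∑ i : Fin (N + 1), g (z i).1) ∂ν = ∫ y : T3, g y * ∫ v : V3, f (0, y, v) := by
  obtain ⟨hi, he⟩ := contactB_onePt_zero ν Φ f hτ hf h0 (fun p : T3 × V3 => g p.1) (hg.comp measurable_fst)
    ⟨C, fun p => hgC p.1⟩
  exact ⟨hi, by rw [he, tv_integral_fst_mul_eq ν Φ f hτ hf hg hgC]⟩

/-! ### Bounded tilts: domination of expectations -/

/-- `((μ S)⁻¹).toReal ≤ δ″⁻¹` when `μ S ≥ δ″ > 0`. -/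
theorem tv_toReal_inv_le {μ : Measure (Phase N)} {S : Set (Phase N)} {δ'' : ℝ} (hδ : 0 < δ'')
    (hS : ENNReal.ofReal δ'' ≤ μ S) : ((μ S)⁻¹).toReal ≤ δ''⁻¹ := by
  have h1 : (μ S)⁻¹ ≤ (ENNReal.ofReal δ'')⁻¹ := ENNReal.inv_le_inv.2 hS
  have h2 : (ENNReal.ofReal δ'')⁻¹ = ENNReal.ofReal δ''⁻¹ := (ENNReal.ofReal_inv_of_pos hδ).symm
  rw [h2] at h1
  have h3 := ENNReal.toReal_mono ENNReal.ofReal_ne_top h1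
  rwa [ENNReal.toReal_ofReal (inv_nonneg.2 hδ.le)] at h3

/-- **Domination of non-negative expectations by a bounded tilt**: `E_{μ(·|S)} F ≤ δ″⁻¹ E_μ F` for `0 ≤ F` integrable
and `μ S ≥ δ″ > 0`. -/
theorem tv_condLaw_integral_le_of_floor (μ : Measure (Phase N)) (S : Set (Phase N)) {δ'' : ℝ} (hδ : 0 < δ'')
    (hS : ENNReal.ofReal δ'' ≤ μ S) (F : Phase N → ℝ) (hF0 : 0 ≤ F) (hF : Integrable F μ) :
    ∫ z, F z ∂(condLaw μ S) ≤ δ''⁻¹ * ∫ z, F z ∂μ :=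
  (contactB_condLaw_integral_le μ S F hF0 hF).trans
    (mul_le_mul_of_nonneg_right (tv_toReal_inv_le hδ hS) (integral_nonneg hF0))

/-! ### Position statistics of the local Gibbs law are `posGibbsMeasure` statistics -/

/-- **The position marginal of the local Gibbs law**: `E_{P_N}[F(x)] = ∫ F d(posGibbsMeasure a₀ ε_N (N+1))` for
measurable `F` of the positions. -/
theorem tv_integral_pos_localGibbsLaw {a₀ θ₀ : T3 → ℝ} {u₀ : T3 → V3} (ha : Continuous a₀) (hθ : Continuous θ₀)
    (hu : Continuous u₀) (ha0 : ∀ x, 0 < a₀ x) (hθ0 : ∀ x, 0 < θ₀ x) (σ : ℝ) (N : ℕ) (Φ : Flow σ N)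
    {F : (Fin (N + 1) → T3) → ℝ} (hF : Measurable F) :
    ∫ z, F (fun i => (z i).1) ∂(localGibbsLaw σ a₀ u₀ θ₀ N Φ) =
      ∫ q, F q ∂(posGibbsMeasure a₀ (hsDiameter σ N) (N + 1)) := by
  rw [localGibbsLaw_eq, ← LGFS.map_pos_localGibbsMeasure ha hθ hu (fun x => (ha0 x).le) hθ0 σ N,
    integral_map (LGFS.measurable_posProj (N + 1)).aemeasurable hF.aestronglyMeasurable]

/-- **The uniform mean-square bound, transported to phase space.**  If the uniform-in-`g` mean-square law of large
numbers of the canonical hard-sphere gas holds at `(profileOf a₀, σ, ε₁, N)` — the registered statics stub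
`stub_oneBodyStatics`, instantiated — then for every measurable `|g| ≤ 1`,
`E_{P_N}((N+1)⁻¹ Σᵢ g(xᵢ) − ∫ g ρ₀)² ≤ ε₁`. -/
theorem tv_meanSquare_le_of_statics {a₀ θ₀ : T3 → ℝ} {u₀ : T3 → V3} (ha : Continuous a₀) (hθ : Continuous θ₀)
    (hu : Continuous u₀) (ha0 : ∀ x, 0 < a₀ x) (hθ0 : ∀ x, 0 < θ₀ x) (σ : ℝ) (N : ℕ) (Φ : Flow σ N) {ε₁ : ℝ}
    (hMLN : ∀ g : T3 → ℝ, Measurable g → (∀ y, |g y| ≤ 1) →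
      (∫ x, ((((N + 1 : ℕ) : ℝ))⁻¹ * ∑ i, g (x i) - ∫ y, g y * rhoLim (profileOf a₀ ha ha0) σ y) ^ 2 *
          efR (Ov (hsDiameter σ N)) x (Finset.univ : Finset (Fin (N + 1)))
          ∂Measure.pi (fun _ : Fin (N + 1) => (profileOf a₀ ha ha0).μ)) / XiN (profileOf a₀ ha ha0) σ N (N + 1) ≤ ε₁)
    {g : T3 → ℝ} (hg : Measurable g) (hg1 : ∀ y, |g y| ≤ 1) :
    ∫ z, ((N + 1 : ℝ)⁻¹ * ∑ i : Fin (N + 1), g (z i).1 - ∫ y, g y * rhoLim (profileOf a₀ ha ha0) σ y) ^ 2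
        ∂(localGibbsLaw σ a₀ u₀ θ₀ N Φ) ≤ ε₁ := by
  set c : ℝ := ∫ y, g y * rhoLim (profileOf a₀ ha ha0) σ y with hc
  have hFm : Measurable fun q : Fin (N + 1) → T3 => ((((N + 1 : ℕ) : ℝ))⁻¹ * ∑ i, g (q i) - c) ^ 2 :=
    (((Finset.measurable_sum _ fun i _ => hg.comp (measurable_pi_apply i)).const_mul _).sub_const _).pow_const 2
  have h1 : ∫ z, ((N + 1 : ℝ)⁻¹ * ∑ i : Fin (N + 1), g (z i).1 - c) ^ 2 ∂(localGibbsLaw σ a₀ u₀ θ₀ N Φ) =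
      ∫ z, (fun q : Fin (N + 1) → T3 => ((((N + 1 : ℕ) : ℝ))⁻¹ * ∑ i, g (q i) - c) ^ 2) (fun i => (z i).1)
        ∂(localGibbsLaw σ a₀ u₀ θ₀ N Φ) := by
    refine integral_congr_ae (ae_of_all _ fun z => ?_)
    push_cast
    rfl
  rw [h1, tv_integral_pos_localGibbsLaw ha hθ hu ha0 hθ0 σ N Φ hFm, LGFS.integral_posGibbs_eq ha ha0 σ N,
    inv_mul_eq_div]
  exact hMLN g hg hg1

/-! ### Conditioning cannot move the one-body position law (total variation) -/

/-- The sign test function of the deviation. -/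
theorem tv_abs_eq_sign_mul (a b : ℝ) : |a - b| = (if b ≤ a then (1 : ℝ) else -1) * (a - b) := by
  split_ifs with h
  · rw [one_mul, abs_of_nonneg (sub_nonneg.2 h)]
  · rw [neg_one_mul, abs_of_neg (sub_neg.2 (lt_of_not_ge h))]

/-- **TV closeness of the one-body position density of every bounded tilt (B′, position half of the statics input).**
Let `a₀, θ₀ > 0`, `u₀` be continuous profiles, `σ ≤ 1/2` in the cluster regime `SmallDensity (profileOf a₀) σ`, and assume
the uniform-in-`g` mean-square law of large numbers of the canonical hard-sphere gas (the registered stub `stub_oneBodyStatics`,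
hypothesis `hML`, verbatim).  Then for every `κ > 0` and mass floor `δ″ > 0` there is `N₀` such that for all `N ≥ N₀`, every
flow, EVERY cell `S` with `P_N(S) ≥ δ″`, every horizon `τ ≥ 0` and every one-particle density `f` of `P_N(·|S)` on `[0,τ]`:
`∫ |∫ f(0,y,v) dv − ρ₀(y)| dy ≤ κ`, `ρ₀ = rhoLim (profileOf a₀) σ`. -/
theorem tv_posDensity_L1_le : ∀ {a₀ θ₀ : T3 → ℝ} {u₀ : T3 → V3} (ha : Continuous a₀) (hθ : Continuous θ₀) (hu : Continuous u₀) (ha0 : ∀ x, 0 < a₀ x) (hθ0 : ∀ x, 0 < θ₀ x) {σ : ℝ}, σ ≤ 1 / 2 → SmallDensity (profileOf a₀ ha ha0) σ → (∀ (P : DensityProfile) (σ : ℝ), SmallDensity P σ → ∀ ε : ℝ, 0 < ε → ∃ N₀ : ℕ, ∀ N : ℕ, N₀ ≤ N → ∀ g : T3 → ℝ, Measurable g → (∀ y, |g y| ≤ 1) → (∫ x, ((((N + 1 : ℕ) : ℝ))⁻¹ * ∑ i, g (x i) - ∫ y, g y * rhoLim P σ y) ^ 2 * efR (Ov (hsDiameter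 σ N)) x (Finset.univ : Finset (Fin (N + 1))) ∂Measure.pi (fun _ : Fin (N + 1) => P.μ)) / XiN P σ N (N + 1) ≤ ε) → ∀ {κ δ'' : ℝ}, 0 < κ → 0 < δ'' → ∃ N₀ : ℕ, ∀ N : ℕ, N₀ ≤ N → ∀ (Φ : Flow σ N) (S : Set (Phase N)), ENNReal.ofReal δ'' ≤ localGibbsLaw σ a₀ u₀ θ₀ N Φ S → ∀ τ : ℝ, 0 ≤ τ → ∀ f : Pt1 → ℝ, IsOneParticleDensity τ (condLaw (localGibbsLaw σ a₀ u₀ θ₀ N Φ) S) Φ f → ∫ y : T3, |(∫ v : V3, f (0, y, v)) - rhoLim (profileOf a₀ ha ha0) σ y| ≤ κ := by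
  intro a₀ θ₀ u₀ ha hθ hu ha0 hθ0 σ hσ hs hML κ δ'' hκ hδ
  set P := profileOf a₀ ha ha0 with hP
  have hε₁ : 0 < (κ * δ'') ^ 2 := by positivity
  obtain ⟨N₀, hN₀⟩ := hML P σ hs ((κ * δ'') ^ 2) hε₁
  refine ⟨N₀, fun N hN Φ S hS τ hτ f hf => ?_⟩
  set μ : Measure (Phase N) := localGibbsLaw σ a₀ u₀ θ₀ N Φ with hμ
  haveI : IsProbabilityMeasure μ := isProbabilityMeasure_localGibbsLaw ha hθ hu ha0 hθ0 hσ N Φ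
  set ν : Measure (Phase N) := condLaw μ S with hν
  haveI : IsProbabilityMeasure ν := contactB_condLaw_isProbability_of_floor μ S δ'' hδ hS
  set n : T3 → ℝ := rhoLim P σ with hn
  set nS : T3 → ℝ := fun y => ∫ v : V3, f (0, y, v) with hnS
  have hnm : Measurable n := hs.continuous_rhoLim.measurable
  have hnSm : Measurable nS := tv_measurable_posDensity hf
  -- the sign test function
  set g : T3 → ℝ := fun y => if n y ≤ nS y then (1 : ℝ) else -1 with hg
  have hgm : Measurable g := Measurable.ite (measurableSet_le hnm hnSm) measurable_const measurable_const
  have hg1 : ∀ y, |g y| ≤ 1 := fun y => by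
    simp only [hg]; split_ifs <;> simp
  -- the deviation integrates against the sign to the L¹ norm
  have habs : ∀ y, |nS y - n y| = g y * (nS y - n y) := fun y => tv_abs_eq_sign_mul (nS y) (n y)
  have hnSi : Integrable nS := tv_integrable_posDensity ν Φ f hτ hf
  have hni : Integrable n := MesoLLN.integrable_T3 hs.continuous_rhoLim
  have hgnSi : Integrable fun y => g y * nS y :=
    hnSi.bdd_mul hgm.aestronglyMeasurable (ae_of_all _ fun y => by rw [Real.norm_eq_abs]; exact hg1 y)
  have hgni : Integrable fun y => g y * n y :=
    hni.bdd_mul hgm.aestronglyMeasurable (ae_of_all _ fun y => by rw [Real.norm_eq_abs]; exact hg1 y)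
  have hsplit : ∫ y, |nS y - n y| = (∫ y, g y * nS y) - ∫ y, g y * n y := by
    rw [← integral_sub hgnSi hgni]
    refine integral_congr_ae (ae_of_all _ fun y => ?_)
    show |nS y - n y| = g y * nS y - g y * n y
    rw [habs]; ring
  -- the empirical statistic and its centring
  set A : Phase N → ℝ := fun z => (N + 1 : ℝ)⁻¹ * ∑ i : Fin (N + 1), g (z i).1 with hA
  set c : ℝ := ∫ y, g y * n y with hc
  obtain ⟨hAi, hAe⟩ := tv_onePt_pos ν Φ f hτ hf (contactB_flow_zero_ae_condLaw σ a₀ θ₀ u₀ Φ S) hgm hg1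
  have hAm : Measurable A :=
    (Finset.measurable_sum _ fun i _ => hgm.comp ((measurable_pi_apply i).fst)).const_mul _
  have hAb : ∀ z, |A z| ≤ 1 := by
    intro z
    have hN1 : (0 : ℝ) < N + 1 := by positivity
    rw [hA]
    dsimp only
    rw [abs_mul, abs_of_pos (inv_pos.2 hN1)]
    calc (N + 1 : ℝ)⁻¹ * |∑ i : Fin (N + 1), g (z i).1| ≤ (N + 1 : ℝ)⁻¹ * ∑ i : Fin (N + 1), |g (z i).1| :=
          mul_le_mul_of_nonneg_left (Finset.abs_sum_le_sum_abs _ _) (inv_nonneg.2 hN1.le)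
      _ ≤ (N + 1 : ℝ)⁻¹ * ∑ _i : Fin (N + 1), (1 : ℝ) :=
          mul_le_mul_of_nonneg_left (Finset.sum_le_sum fun i _ => hg1 _) (inv_nonneg.2 hN1.le)
      _ = 1 := by
          rw [Finset.sum_const, Finset.card_univ, Fintype.card_fin, nsmul_eq_mul, mul_one]
          push_cast
          exact inv_mul_cancel₀ hN1.ne'
  have hAcm : Measurable fun z => |A z - c| := (hAm.sub_const c).abs
  have hAcb : ∀ z, |A z - c| ≤ 1 + |c| := fun z => (abs_sub _ _).trans (by linarith [hAb z])
  have hAci : Integrable (fun z => |A z - c|) μ :=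
    (integrable_const (1 + |c|)).mono' hAcm.aestronglyMeasurable
      (ae_of_all _ fun z => by rw [Real.norm_eq_abs, abs_abs]; exact hAcb z)
  -- step 1: `|E_ν A − c| ≤ E_ν |A − c|`
  have step1 : |(∫ z, A z ∂ν) - c| ≤ ∫ z, |A z - c| ∂ν := by
    have h1 : (∫ z, A z ∂ν) - c = ∫ z, (A z - c) ∂ν := by
      rw [integral_sub hAi (integrable_const c), integral_const, probReal_univ, one_smul]
    rw [h1]
    exact abs_integral_le_integral_abs
  -- step 2: domination by the bounded tilt
  have step2 : ∫ z, |A z - c| ∂ν ≤ δ''⁻¹ * ∫ z, |A z - c| ∂μ :=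
    tv_condLaw_integral_le_of_floor μ S hδ hS _ (fun z => abs_nonneg _) hAci
  -- step 3: Cauchy–Schwarz under `P_N`
  have step3 : ∫ z, |A z - c| ∂μ ≤ Real.sqrt (∫ z, (A z - c) ^ 2 ∂μ) :=
    LGFS.integral_abs_le_sqrt (hAm.sub_const c) hAcb
  -- step 4: the uniform mean-square bound
  have step4 : ∫ z, (A z - c) ^ 2 ∂μ ≤ (κ * δ'') ^ 2 :=
    tv_meanSquare_le_of_statics ha hθ hu ha0 hθ0 σ N Φ (hN₀ N hN) hgm hg1
  have step5 : Real.sqrt (∫ z, (A z - c) ^ 2 ∂μ) ≤ κ * δ'' := by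
    rw [← Real.sqrt_sq (by positivity : (0 : ℝ) ≤ κ * δ'')]
    exact Real.sqrt_le_sqrt step4
  -- assemble
  calc ∫ y, |nS y - n y| = (∫ z, A z ∂ν) - c := by rw [hsplit, hAe]
    _ ≤ |(∫ z, A z ∂ν) - c| := le_abs_self _
    _ ≤ δ''⁻¹ * (κ * δ'') := step1.trans (step2.trans (mul_le_mul_of_nonneg_left (step3.trans step5)
        (inv_nonneg.2 hδ.le)))
    _ = κ := by field_simp

/-! ### Conditioning cannot concentrate the one-body position law (a sup bound) -/

/-- **Mass of a set under the one-body position law of a bounded tilt**: `∫_B n_S ≤ (2M/δ″)·|B|` for every measurable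
`B ⊆ 𝕋³` (`ν ≤ δ″⁻¹ P_N`; the position statistic of `P_N` is the one-point expectation `E_{N+1}[𝟙_B(q₀)] ≤ 2 ∫ 𝟙_B β`
of the cluster files; `β ≤ M`). -/
theorem tv_setIntegral_posDensity_le {a₀ θ₀ : T3 → ℝ} {u₀ : T3 → V3} (ha : Continuous a₀) (hθ : Continuous θ₀)
    (hu : Continuous u₀) (ha0 : ∀ x, 0 < a₀ x) (hθ0 : ∀ x, 0 < θ₀ x) {σ : ℝ} (hσ : σ ≤ 1 / 2)
    (hs : SmallDensity (profileOf a₀ ha ha0) σ) {N : ℕ} (Φ : Flow σ N) (S : Set (Phase N)) {δ'' : ℝ} (hδ : 0 < δ'')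
    (hS : ENNReal.ofReal δ'' ≤ localGibbsLaw σ a₀ u₀ θ₀ N Φ S) {τ : ℝ} (hτ : 0 ≤ τ) {f : Pt1 → ℝ}
    (hf : IsOneParticleDensity τ (condLaw (localGibbsLaw σ a₀ u₀ θ₀ N Φ) S) Φ f) {B : Set T3} (hB : MeasurableSet B) :
    ∫ y in B, (∫ v : V3, f (0, y, v)) ≤ 2 * (profileOf a₀ ha ha0).M / δ'' * (volume B).toReal := by
  set P := profileOf a₀ ha ha0 with hP
  set μ : Measure (Phase N) := localGibbsLaw σ a₀ u₀ θ₀ N Φ with hμ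
  haveI : IsProbabilityMeasure μ := isProbabilityMeasure_localGibbsLaw ha hθ hu ha0 hθ0 hσ N Φ
  set ν : Measure (Phase N) := condLaw μ S with hν
  haveI : IsProbabilityMeasure ν := contactB_condLaw_isProbability_of_floor μ S δ'' hδ hS
  set nS : T3 → ℝ := fun y => ∫ v : V3, f (0, y, v) with hnS
  -- the indicator test function
  set g : T3 → ℝ := B.indicator (fun _ => (1 : ℝ)) with hg
  have hgm : Measurable g := measurable_const.indicator hB
  have hg0 : ∀ y, 0 ≤ g y := fun y => Set.indicator_nonneg (fun _ _ => zero_le_one) y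
  have hg1 : ∀ y, |g y| ≤ 1 := fun y => by
    rw [abs_of_nonneg (hg0 y)]
    exact Set.indicator_le_self' (fun _ _ => zero_le_one) y
  -- `∫_B n_S = ∫ g n_S = E_ν[(N+1)⁻¹ Σ g(xᵢ)]`
  have h1 : ∫ y in B, nS y = ∫ y, g y * nS y := by
    rw [← integral_indicator hB]
    refine integral_congr_ae (ae_of_all _ fun y => ?_)
    show B.indicator nS y = B.indicator (fun _ => (1 : ℝ)) y * nS y
    by_cases hy : y ∈ B
    · rw [Set.indicator_of_mem hy, Set.indicator_of_mem hy, one_mul]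
    · rw [Set.indicator_of_notMem hy, Set.indicator_of_notMem hy, zero_mul]
  obtain ⟨hAi, hAe⟩ := tv_onePt_pos ν Φ f hτ hf (contactB_flow_zero_ae_condLaw σ a₀ θ₀ u₀ Φ S) hgm hg1
  set A : Phase N → ℝ := fun z => (N + 1 : ℝ)⁻¹ * ∑ i : Fin (N + 1), g (z i).1 with hA
  have hAm : Measurable A :=
    (Finset.measurable_sum _ fun i _ => hgm.comp ((measurable_pi_apply i).fst)).const_mul _
  have hA0 : 0 ≤ A := fun z => mul_nonneg (inv_nonneg.2 (by positivity)) (Finset.sum_nonneg fun i _ => hg0 _)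
  have hAb : ∀ z, |A z| ≤ 1 := by
    intro z
    have hN1 : (0 : ℝ) < N + 1 := by positivity
    rw [hA]
    dsimp only
    rw [abs_mul, abs_of_pos (inv_pos.2 hN1)]
    calc (N + 1 : ℝ)⁻¹ * |∑ i : Fin (N + 1), g (z i).1| ≤ (N + 1 : ℝ)⁻¹ * ∑ i : Fin (N + 1), |g (z i).1| :=
          mul_le_mul_of_nonneg_left (Finset.abs_sum_le_sum_abs _ _) (inv_nonneg.2 hN1.le)
      _ ≤ (N + 1 : ℝ)⁻¹ * ∑ _i : Fin (N + 1), (1 : ℝ) :=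
          mul_le_mul_of_nonneg_left (Finset.sum_le_sum fun i _ => hg1 _) (inv_nonneg.2 hN1.le)
      _ = 1 := by
          rw [Finset.sum_const, Finset.card_univ, Fintype.card_fin, nsmul_eq_mul, mul_one]
          push_cast
          exact inv_mul_cancel₀ hN1.ne'
  have hAiμ : Integrable A μ :=
    (integrable_const (1 : ℝ)).mono' hAm.aestronglyMeasurable
      (ae_of_all _ fun z => by rw [Real.norm_eq_abs]; exact hAb z)
  -- domination by the bounded tilt
  have h2 : ∫ z, A z ∂ν ≤ δ''⁻¹ * ∫ z, A z ∂μ := tv_condLaw_integral_le_of_floor μ S hδ hS A hA0 hAiμ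
  -- the position statistic of `P_N` is the one-point expectation
  have h3 : ∫ z, A z ∂μ = onePt P σ g N 0 := by
    have hFm : Measurable fun q : Fin (N + 1) → T3 => (((N + 1 : ℕ) : ℝ))⁻¹ * ∑ i, g (q i) :=
      (Finset.measurable_sum _ fun i _ => hgm.comp (measurable_pi_apply i)).const_mul _
    have e1 : ∫ z, A z ∂μ = ∫ z, (fun q : Fin (N + 1) → T3 => (((N + 1 : ℕ) : ℝ))⁻¹ * ∑ i, g (q i))
        (fun i => (z i).1) ∂μ := by
      refine integral_congr_ae (ae_of_all _ fun z => ?_)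
      rw [hA]
      push_cast
      rfl
    rw [e1, tv_integral_pos_localGibbsLaw ha hθ hu ha0 hθ0 σ N Φ hFm, LGFS.integral_avg_posGibbs_eq_onePt ha ha0 σ N hgm hg1]
  -- the insertion bound of the cluster files and `β ≤ M`
  have h4 : onePt P σ g N 0 ≤ 2 * ∫ y, g y ∂P.μ := LGFS.onePt_le_two_mul hs hgm hg1 hg0 (Nat.zero_le N)
  have h5 : ∫ y, g y ∂P.μ ≤ P.M * (volume B).toReal := by
    rw [LGFS.integral_kernel_μ_eq P g]
    have e2 : (fun y => g y * P.β y) = B.indicator P.β := by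
      funext y
      by_cases hy : y ∈ B
      · rw [hg, Set.indicator_of_mem hy, Set.indicator_of_mem hy, one_mul]
      · rw [hg, Set.indicator_of_notMem hy, Set.indicator_of_notMem hy, zero_mul]
    rw [e2, integral_indicator hB]
    calc ∫ y in B, P.β y ≤ ∫ _y in B, P.M := by
          refine setIntegral_mono_on (MesoLLN.integrable_T3 P.continuous).integrableOn
            (integrableOn_const (measure_ne_top _ _)) hB fun y _ => P.le_M y
      _ = P.M * (volume B).toReal := by
          rw [setIntegral_const, smul_eq_mul, mul_comm]
          rfl
  calc ∫ y in B, nS y = ∫ z, A z ∂ν := by rw [h1, hAe]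
    _ ≤ δ''⁻¹ * (2 * (P.M * (volume B).toReal)) :=
        h2.trans (mul_le_mul_of_nonneg_left (by rw [h3]; exact h4.trans (by linarith [h5])) (inv_nonneg.2 hδ.le))
    _ = 2 * P.M / δ'' * (volume B).toReal := by ring

/-- **Sup bound for the one-body position density of every bounded tilt (B′, second statics-side input)**: under the
hypotheses of `tv_setIntegral_posDensity_le`, `∫ f(0, y, v) dv ≤ 2M/δ″` for a.e. `y ∈ 𝕋³`. -/
theorem tv_posDensity_le_ae : ∀ {a₀ θ₀ : T3 → ℝ} {u₀ : T3 → V3} (ha : Continuous a₀) (hθ : Continuous θ₀) (hu : Continuous u₀) (ha0 : ∀ x, 0 < a₀ x) (hθ0 : ∀ x, 0 < θ₀ x) {σ : ℝ}, σ ≤ 1 / 2 → SmallDensity (profileOf a₀ ha ha0) σ → ∀ {N : ℕ} (Φ : Flow σ N) (S : Set (Phase N)) {δ'' : ℝ}, 0 < δ'' → ENNReal.ofReal δ'' ≤ localGibbsLaw σ a₀ u₀ θ₀ N Φ S → ∀ {τ : ℝ}, 0 ≤ τ → ∀ {f : Pt1 → ℝ}, IsOneParticleDensity τ (condLaw (localGibbsLaw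 σ a₀ u₀ θ₀ N Φ) S) Φ f → ∀ᵐ y : T3, (∫ v : V3, f (0, y, v)) ≤ 2 * (profileOf a₀ ha ha0).M / δ'' := by
  intro a₀ θ₀ u₀ ha hθ hu ha0 hθ0 σ hσ hs N Φ S δ'' hδ hS τ hτ f hf
  set μ : Measure (Phase N) := localGibbsLaw σ a₀ u₀ θ₀ N Φ with hμ
  haveI : IsProbabilityMeasure μ := isProbabilityMeasure_localGibbsLaw ha hθ hu ha0 hθ0 hσ N Φ
  haveI : IsProbabilityMeasure (condLaw μ S) := contactB_condLaw_isProbability_of_floor μ S δ'' hδ hS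
  refine ae_le_of_forall_setIntegral_le (tv_integrable_posDensity (condLaw μ S) Φ f hτ hf) (integrable_const _)
    fun B hB _ => ?_
  rw [setIntegral_const, smul_eq_mul, mul_comm]
  exact tv_setIntegral_posDensity_le ha hθ hu ha0 hθ0 hσ hs Φ S hδ hS hτ hf hB

end Summit.AtomisticToContinuum.HydrodynamicLimit.Theorems.LocalSecondLawInitialMatching

end
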